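import Summits.FinalStateConjecture.FinalStateConjecture.Theorems.PhotonSphereChannelsWindowedShellChannelsStubLostPSD
import Literature.Analysis.PDE.Wave1DExteriorEnergy
import Literature.Analysis.PDE.Wave1DFarEnergyLimits

/-!
# Crux `WindowedShellChannels` (stmt-FinalStateConjecture-14085), line `Sketch`, stub `stub_dropPSD` —
# the one-sided windowed energy drop is a positive semidefinite quadratic form

The registered stub `stub_dropPSD` of line `Sketch`, over the Literature vocabulary
`ReggeWheeler.{IsSolution, totalEnergy, farEnergy, energyDensity}`.  For `V ≥ 0` differentiable, two
finite-energy global `C²` solutions `u, v` of `ψ_tt − ψ_xx + Vψ = 0`, an edge `a`, a weight `η > 0`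
and times `0 ≤ T ≤ t`:

`far_T(u + v) + (1 + η)·far_t(u) + (1 + η⁻¹)·far_t(v) ≤ far_t(u + v) + (1 + η)·far_T(u) + (1 + η⁻¹)·far_T(v)`

(`far_τ(φ) = farEnergy V a φ τ = ∫⁻_{x > a + |τ|} e[φ](τ, ·)`), i.e. the drop
`drop(φ) := far_T(φ) − far_t(φ) ≥ 0` of the one-sided far energy over `[T, t]` satisfies
`drop(u + v) ≤ (1 + η) drop(u) + (1 + η⁻¹) drop(v)`, written additively in `[0, ∞]`.

Proof (sub-namespace `DropPSD`):

* `DropPSD.flux_le_drop` / `DropPSD.drop_le_flux` / `DropPSD.farEnergy_drop_eq_flux` — **the flux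
  identity**: for a finite-energy `C²` solution and `0 ≤ T ≤ t`,
  `∫_{x > a+T} e(T, ·) − ∫_{x > a+t} e(t, ·) = ∫_{a+T}^{a+t} [(φ_t + φ_x)² + Vφ²](x − a, x) dx`
  (the outgoing flux through the moving edge `x = a + τ`).  Lower bound: the characteristic
  trapezoid identity `Literature.Analysis.PDE.wave1D_trapezoid_energy_identity` on
  `{T ≤ τ ≤ t, a + τ ≤ x ≤ b − τ}` with the (signed) right-edge term dropped, then `b → ∞`
  (`MeasureTheory.intervalIntegral_tendsto_integral_Ioi`, the far energies being finite).  Upper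
  bound: the difference of the trapezoid identities on `[a, b + 2t]` and `[b, b + 2t]` is the
  identity on the parallelogram `{a + τ ≤ x ≤ b + τ}`, whose right-edge term is an outgoing flux of
  the same (nonnegative) kind; drop it and let `b → ∞`;
* `DropPSD.flux_add_le` — the edge flux is a pointwise positive semidefinite form, so
  `Φ[u + v] ≤ (1 + η) Φ[u] + (1 + η⁻¹) Φ[v]` (`2pq ≤ ηp² + η⁻¹q²`, `LostPSD.two_mul_le_weighted`),
  and the same for the integrals over `[a + T, a + t]` (`DropPSD.integral_flux_add_le`);
* the main theorem converts the six (finite) far energies to real integrals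
  (`Literature.Analysis.PDE.integrableOn_Ioi_of_lintegral_lt_top`, finiteness by
  `farEnergy ≤ totalEnergy` and conservation `RW.totalEnergy_eq_totalEnergy`) and adds up.

Standard material [folklore]; no new definitions; the import closure is that of the landed
`…StubLostPSD` plus the Literature files `Wave1DExteriorEnergy`, `Wave1DFarEnergyLimits`.
-/

noncomputable section

-- the tree's namespace `Summit.FinalStateConjecture.FinalStateConjecture.Theorems` repeats a component by design
-- (problem directory `Summits/FinalStateConjecture/FinalStateConjecture/…`), as in every landed file of this line
set_option linter.dupNamespace false

namespace Summit.FinalStateConjecture.FinalStateConjecture.Theorems.WindowedShellChannelsSketch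

open Literature.Geometry.Lorentzian Literature.Geometry.Lorentzian.ReggeWheeler Filter Set MeasureTheory
open Summit.FinalStateConjecture.FinalStateConjecture.Theorems.WindowedShellChannelsStubs
open Literature.Analysis.PDE Literature.Analysis.Calculus
open scoped ENNReal Topology

namespace DropPSD

variable {V : ℝ → ℝ} {ψ u v : ℝ → ℝ → ℝ}

/-! ### The outgoing edge flux `Φ[ψ](x) = (ψ_t + ψ_x)²(x − a, x) + V(x) ψ(x − a, x)²` -/

/-- The edge-flux integrand `x ↦ (ψ_t + ψ_x)²(x − a, x) + V(x) ψ(x − a, x)²` of a `C²` function is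
continuous (`V` continuous). [folklore] -/
theorem continuous_flux (hV : Continuous V) (hψ : ContDiff ℝ 2 (Function.uncurry ψ)) (a : ℝ) :
    Continuous fun x => (deriv (fun τ => ψ τ x) (x - a) + deriv (ψ (x - a)) x) ^ 2
      + V x * ψ (x - a) x ^ 2 := by
  obtain ⟨ψt, ψx, ψtt, ψtx, ψxx, hct, hcx, -, -, -, h1, h2, -⟩ := exists_partials_of_contDiff_two hψ
  have hd1 : ∀ t x, deriv (fun τ => ψ τ x) t = ψt t x := fun t x => (h1 t x).deriv
  have hd2 : ∀ t x, deriv (ψ t) x = ψx t x := fun t x => (h2 t x).deriv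
  simp only [hd1, hd2]
  have hp : Continuous fun x : ℝ => (x - a, x) := (continuous_id.sub continuous_const).prodMk continuous_id
  have ha : Continuous fun x : ℝ => ψt (x - a) x := hct.comp hp
  have hb : Continuous fun x : ℝ => ψx (x - a) x := hcx.comp hp
  have hc : Continuous fun x : ℝ => ψ (x - a) x := hψ.continuous.comp hp
  fun_prop

/-- `t`-slices of a `C²` function are differentiable. [folklore] -/
theorem differentiableAt_slice_fst (h : ContDiff ℝ 2 (Function.uncurry ψ)) (s y : ℝ) :
    DifferentiableAt ℝ (fun τ => ψ τ y) s :=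
  have h' : ContDiff ℝ 2 (fun τ => ψ τ y) := h.comp (contDiff_id.prodMk contDiff_const)
  (h'.differentiable (by norm_num)) s

/-- `x`-slices of a `C²` function are differentiable. [folklore] -/
theorem differentiableAt_slice_snd (h : ContDiff ℝ 2 (Function.uncurry ψ)) (s y : ℝ) :
    DifferentiableAt ℝ (ψ s) y :=
  have h' : ContDiff ℝ 2 (ψ s) := h.comp (contDiff_const.prodMk contDiff_id)
  (h'.differentiable (by norm_num)) y

/-- **The edge flux is a positive semidefinite form**: for `C²` functions `u, v`, `η > 0` and
`V x ≥ 0`, `Φ[u + v](x) ≤ (1 + η) Φ[u](x) + (1 + η⁻¹) Φ[v](x)` (expand and use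
`2pq ≤ ηp² + η⁻¹q²` for the two products). [folklore] -/
theorem flux_add_le (hV0 : ∀ x, 0 ≤ V x) (hu : ContDiff ℝ 2 (Function.uncurry u))
    (hv : ContDiff ℝ 2 (Function.uncurry v)) {η : ℝ} (hη : 0 < η) (a x : ℝ) :
    (deriv (fun τ => u τ x + v τ x) (x - a) + deriv (fun y => u (x - a) y + v (x - a) y) x) ^ 2
        + V x * (u (x - a) x + v (x - a) x) ^ 2
      ≤ (1 + η) * ((deriv (fun τ => u τ x) (x - a) + deriv (u (x - a)) x) ^ 2
          + V x * u (x - a) x ^ 2)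
        + (1 + η⁻¹) * ((deriv (fun τ => v τ x) (x - a) + deriv (v (x - a)) x) ^ 2
          + V x * v (x - a) x ^ 2) := by
  have e1 : deriv (fun τ => u τ x + v τ x) (x - a)
      = deriv (fun τ => u τ x) (x - a) + deriv (fun τ => v τ x) (x - a) :=
    deriv_fun_add (differentiableAt_slice_fst hu _ _) (differentiableAt_slice_fst hv _ _)
  have e2 : deriv (fun y => u (x - a) y + v (x - a) y) x = deriv (u (x - a)) x + deriv (v (x - a)) x :=
    deriv_fun_add (differentiableAt_slice_snd hu _ _) (differentiableAt_slice_snd hv _ _)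
  rw [e1, e2]
  have hp := LostPSD.two_mul_le_weighted hη (deriv (fun τ => v τ x) (x - a) + deriv (v (x - a)) x)
    (deriv (fun τ => u τ x) (x - a) + deriv (u (x - a)) x)
  have hq := mul_le_mul_of_nonneg_left (LostPSD.two_mul_le_weighted hη (v (x - a) x) (u (x - a) x))
    (hV0 x)
  nlinarith [hp, hq, hV0 x]

/-- The integrated form of `flux_add_le` over `[a + T, a + t]` (`T ≤ t`, `V ≥ 0` continuous).
[folklore] -/
theorem integral_flux_add_le (hV : Continuous V) (hV0 : ∀ x, 0 ≤ V x)
    (hu : ContDiff ℝ 2 (Function.uncurry u)) (hv : ContDiff ℝ 2 (Function.uncurry v))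
    {η : ℝ} (hη : 0 < η) (a : ℝ) {T t : ℝ} (hTt : T ≤ t) :
    (∫ x in (a + T)..(a + t), ((deriv (fun τ => u τ x + v τ x) (x - a)
        + deriv (fun y => u (x - a) y + v (x - a) y) x) ^ 2 + V x * (u (x - a) x + v (x - a) x) ^ 2))
      ≤ (1 + η) * (∫ x in (a + T)..(a + t), ((deriv (fun τ => u τ x) (x - a) + deriv (u (x - a)) x) ^ 2
          + V x * u (x - a) x ^ 2))
        + (1 + η⁻¹) * ∫ x in (a + T)..(a + t), ((deriv (fun τ => v τ x) (x - a)
          + deriv (v (x - a)) x) ^ 2 + V x * v (x - a) x ^ 2) := by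
  have cu := continuous_flux hV hu a
  have cv := continuous_flux hV hv a
  have cs : Continuous fun x => (deriv (fun τ => u τ x + v τ x) (x - a)
      + deriv (fun y => u (x - a) y + v (x - a) y) x) ^ 2 + V x * (u (x - a) x + v (x - a) x) ^ 2 :=
    continuous_flux hV (ψ := fun t x => u t x + v t x) (hu.add hv) a
  have iu : IntervalIntegrable (fun x => (1 + η) * ((deriv (fun τ => u τ x) (x - a)
      + deriv (u (x - a)) x) ^ 2 + V x * u (x - a) x ^ 2)) volume (a + T) (a + t) :=
    (cu.const_mul (1 + η)).intervalIntegrable _ _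
  have iv : IntervalIntegrable (fun x => (1 + η⁻¹) * ((deriv (fun τ => v τ x) (x - a)
      + deriv (v (x - a)) x) ^ 2 + V x * v (x - a) x ^ 2)) volume (a + T) (a + t) :=
    (cv.const_mul (1 + η⁻¹)).intervalIntegrable _ _
  calc (∫ x in (a + T)..(a + t), ((deriv (fun τ => u τ x + v τ x) (x - a)
        + deriv (fun y => u (x - a) y + v (x - a) y) x) ^ 2 + V x * (u (x - a) x + v (x - a) x) ^ 2))
      ≤ ∫ x in (a + T)..(a + t),
          ((1 + η) * ((deriv (fun τ => u τ x) (x - a) + deriv (u (x - a)) x) ^ 2 + V x * u (x - a) x ^ 2)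
          + (1 + η⁻¹) * ((deriv (fun τ => v τ x) (x - a) + deriv (v (x - a)) x) ^ 2
            + V x * v (x - a) x ^ 2)) :=
        intervalIntegral.integral_mono_on (by linarith) (cs.intervalIntegrable _ _) (iu.add iv)
          fun x _ => flux_add_le hV0 hu hv hη a x
    _ = _ := by
        rw [intervalIntegral.integral_add iu iv, intervalIntegral.integral_const_mul,
          intervalIntegral.integral_const_mul]

/-! ### The flux identity for the one-sided far energy -/

section Flux

variable (hV : Continuous V) (hV0 : ∀ x, 0 ≤ V x) (hψ : ContDiff ℝ 2 (Function.uncurry ψ))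
  (hsol : ∀ t x, iteratedDeriv 2 (fun τ => ψ τ x) t - iteratedDeriv 2 (ψ t) x + V x * ψ t x = 0)
include hV hV0 hψ hsol

/-- **Flux bound from below.** For a `C²` solution of `ψ_tt − ψ_xx + Vψ = 0` (`V ≥ 0` continuous),
`T ≤ t`, and integrable energy densities on the two half-lines,
`∫_{a+T}^{a+t} Φ[ψ] ≤ ∫_{x > a+T} e(T, ·) − ∫_{x > a+t} e(t, ·)`: the trapezoid identity on
`{T ≤ τ ≤ t, a + τ ≤ x ≤ b − τ}` with its nonnegative right-edge flux dropped, and `b → ∞`.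
[folklore] -/
theorem flux_le_drop {a T t : ℝ} (hTt : T ≤ t)
    (hiT : IntegrableOn (fun x => energyDensity V ψ T x) (Ioi (a + T)))
    (hit : IntegrableOn (fun x => energyDensity V ψ t x) (Ioi (a + t))) :
    (∫ x in (a + T)..(a + t), ((deriv (fun τ => ψ τ x) (x - a) + deriv (ψ (x - a)) x) ^ 2
        + V x * ψ (x - a) x ^ 2))
      ≤ (∫ x in Ioi (a + T), energyDensity V ψ T x) - ∫ x in Ioi (a + t), energyDensity V ψ t x := by
  have hbt : Tendsto (fun b : ℝ => b - t) atTop atTop :=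
    tendsto_atTop_atTop.2 fun c => ⟨c + t, fun b hb => by linarith⟩
  have hbT : Tendsto (fun b : ℝ => b - T) atTop atTop :=
    tendsto_atTop_atTop.2 fun c => ⟨c + T, fun b hb => by linarith⟩
  have h1 : Tendsto (fun b => ∫ x in (a + t)..(b - t), energyDensity V ψ t x) atTop
      (𝓝 (∫ x in Ioi (a + t), energyDensity V ψ t x)) :=
    intervalIntegral_tendsto_integral_Ioi (a + t) hit hbt
  have h2 : Tendsto (fun b => ∫ x in (a + T)..(b - T), energyDensity V ψ T x) atTop
      (𝓝 (∫ x in Ioi (a + T), energyDensity V ψ T x)) :=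
    intervalIntegral_tendsto_integral_Ioi (a + T) hiT hbT
  have hle : ∀ᶠ b in atTop, (∫ x in (a + t)..(b - t), energyDensity V ψ t x)
      + (∫ x in (a + T)..(a + t), ((deriv (fun τ => ψ τ x) (x - a) + deriv (ψ (x - a)) x) ^ 2
        + V x * ψ (x - a) x ^ 2))
      ≤ ∫ x in (a + T)..(b - T), energyDensity V ψ T x := by
    filter_upwards [eventually_ge_atTop (a + 2 * t)] with b hb
    have hid := wave1D_trapezoid_energy_identity hV hψ hsol (a := a) (b := b) hTt (by linarith)
    have hR : 0 ≤ ∫ x in (b - t)..(b - T), ((deriv (fun τ => ψ τ x) (b - x) - deriv (ψ (b - x)) x) ^ 2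
        + V x * ψ (b - x) x ^ 2) :=
      intervalIntegral.integral_nonneg (by linarith) fun x _ => by have := hV0 x; positivity
    simp only [energyDensity]
    linarith
  have := le_of_tendsto_of_tendsto (h1.add_const _) h2 hle
  linarith

/-- **Flux bound from above.** Under the same hypotheses,
`∫_{x > a+T} e(T, ·) − ∫_{x > a+t} e(t, ·) ≤ ∫_{a+T}^{a+t} Φ[ψ]`: subtracting the trapezoid
identities on the bases `[a, b + 2t]` and `[b, b + 2t]` gives the identity on the parallelogram
`{T ≤ τ ≤ t, a + τ ≤ x ≤ b + τ}`, whose right-edge term is again a nonnegative outgoing flux; drop it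
and let `b → ∞`. [folklore] -/
theorem drop_le_flux {a T t : ℝ} (hTt : T ≤ t)
    (hiT : IntegrableOn (fun x => energyDensity V ψ T x) (Ioi (a + T)))
    (hit : IntegrableOn (fun x => energyDensity V ψ t x) (Ioi (a + t))) :
    (∫ x in Ioi (a + T), energyDensity V ψ T x) - (∫ x in Ioi (a + t), energyDensity V ψ t x)
      ≤ ∫ x in (a + T)..(a + t), ((deriv (fun τ => ψ τ x) (x - a) + deriv (ψ (x - a)) x) ^ 2
        + V x * ψ (x - a) x ^ 2) := by
  have hbt : Tendsto (fun b : ℝ => b + t) atTop atTop :=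
    tendsto_atTop_atTop.2 fun c => ⟨c - t, fun b hb => by linarith⟩
  have hbT : Tendsto (fun b : ℝ => b + T) atTop atTop :=
    tendsto_atTop_atTop.2 fun c => ⟨c - T, fun b hb => by linarith⟩
  have h1 : Tendsto (fun b => ∫ x in (a + t)..(b + t), energyDensity V ψ t x) atTop
      (𝓝 (∫ x in Ioi (a + t), energyDensity V ψ t x)) :=
    intervalIntegral_tendsto_integral_Ioi (a + t) hit hbt
  have h2 : Tendsto (fun b => ∫ x in (a + T)..(b + T), energyDensity V ψ T x) atTop
      (𝓝 (∫ x in Ioi (a + T), energyDensity V ψ T x)) :=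
    intervalIntegral_tendsto_integral_Ioi (a + T) hiT hbT
  have hc : ∀ τ : ℝ, Continuous fun x => energyDensity V ψ τ x := fun τ =>
    (continuous_wave1D_energyDensity hV hψ).comp (continuous_const.prodMk continuous_id)
  have hle : ∀ᶠ b in atTop, (∫ x in (a + T)..(b + T), energyDensity V ψ T x)
      ≤ (∫ x in (a + t)..(b + t), energyDensity V ψ t x)
        + ∫ x in (a + T)..(a + t), ((deriv (fun τ => ψ τ x) (x - a) + deriv (ψ (x - a)) x) ^ 2
          + V x * ψ (x - a) x ^ 2) := by
    filter_upwards [eventually_ge_atTop a] with b hb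
    have hA := wave1D_trapezoid_energy_identity hV hψ hsol (a := a) (b := b + 2 * t) hTt (by linarith)
    have hB := wave1D_trapezoid_energy_identity hV hψ hsol (a := b) (b := b + 2 * t) hTt (by linarith)
    have hLb : 0 ≤ ∫ x in (b + T)..(b + t), ((deriv (fun τ => ψ τ x) (x - b) + deriv (ψ (x - b)) x) ^ 2
        + V x * ψ (x - b) x ^ 2) :=
      intervalIntegral.integral_nonneg (by linarith) fun x _ => by have := hV0 x; positivity
    have hst : (∫ x in (a + t)..(b + 2 * t - t), energyDensity V ψ t x)
        = (∫ x in (a + t)..(b + t), energyDensity V ψ t x)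
          + ∫ x in (b + t)..(b + 2 * t - t), energyDensity V ψ t x :=
      (intervalIntegral.integral_add_adjacent_intervals ((hc t).intervalIntegrable _ _)
        ((hc t).intervalIntegrable _ _)).symm
    have hsT : (∫ x in (a + T)..(b + 2 * t - T), energyDensity V ψ T x)
        = (∫ x in (a + T)..(b + T), energyDensity V ψ T x)
          + ∫ x in (b + T)..(b + 2 * t - T), energyDensity V ψ T x :=
      (intervalIntegral.integral_add_adjacent_intervals ((hc T).intervalIntegrable _ _)
        ((hc T).intervalIntegrable _ _)).symm
    simp only [energyDensity] at hst hsT ⊢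
    linarith
  have := le_of_tendsto_of_tendsto h2 (h1.add_const _) hle
  linarith

end Flux

/-! ### Finite-energy solutions: the drop of the far energy is the edge flux -/

/-- For `τ ≥ 0` the far energy is the energy on the half-line `(a + τ, ∞)`. [folklore] -/
theorem farEnergy_eq_lintegral_Ioi (a : ℝ) {τ : ℝ} (hτ : 0 ≤ τ) (φ : ℝ → ℝ → ℝ) :
    farEnergy V a φ τ = ∫⁻ x in Ioi (a + τ), ENNReal.ofReal (energyDensity V φ τ x) := by
  have hS : {x : ℝ | a + |τ| < x} = Ioi (a + τ) := by
    rw [abs_of_nonneg hτ]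
    rfl
  unfold farEnergy
  rw [hS]

section Solutions

variable (hV : Differentiable ℝ V) (hV0 : ∀ x, 0 ≤ V x) {φ : ℝ → ℝ → ℝ}
include hV hV0

/-- Far energies of a finite-energy global solution are finite (`farEnergy ≤ totalEnergy`, which is
conserved). [folklore] -/
theorem farEnergy_lt_top (hφ : IsSolution V φ) (hE : totalEnergy V φ 0 ≠ ⊤) (a τ : ℝ) :
    farEnergy V a φ τ < ⊤ :=
  calc farEnergy V a φ τ ≤ totalEnergy V φ τ := farEnergy_le_totalEnergy V a φ τ
    _ = totalEnergy V φ 0 := RW.totalEnergy_eq_totalEnergy hV hV0 hφ τ 0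
    _ < ⊤ := lt_top_iff_ne_top.2 hE

/-- **Real form of the far energy** of a finite-energy global solution at a time `τ ≥ 0`: the energy
density is integrable on `(a + τ, ∞)` and `farEnergy V a φ τ = ofReal (∫_{x > a+τ} e(τ, ·))`.
[folklore] -/
theorem farEnergy_eq_ofReal (hφ : IsSolution V φ) (hE : totalEnergy V φ 0 ≠ ⊤) (a : ℝ) {τ : ℝ}
    (hτ : 0 ≤ τ) :
    IntegrableOn (fun x => energyDensity V φ τ x) (Ioi (a + τ)) ∧
      farEnergy V a φ τ = ENNReal.ofReal (∫ x in Ioi (a + τ), energyDensity V φ τ x) := by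
  have hfin : ∫⁻ x in Ioi (a + τ), ENNReal.ofReal (energyDensity V φ τ x) < ⊤ := by
    rw [← farEnergy_eq_lintegral_Ioi a hτ φ]
    exact farEnergy_lt_top hV hV0 hφ hE a τ
  have h := integrableOn_Ioi_of_lintegral_lt_top (RW.continuous_energyDensity_slice hV hφ.1 τ)
    (fun x => energyDensity_nonneg φ τ (hV0 x)) hfin
  rw [farEnergy_eq_lintegral_Ioi a hτ φ]
  exact ⟨h.1, h.2.symm⟩

/-- **The flux identity.** For a finite-energy global `C²` solution of `ψ_tt − ψ_xx + Vψ = 0`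
(`V ≥ 0` differentiable), an edge `a` and `0 ≤ T ≤ t`:
`∫_{x > a+T} e(T, ·) − ∫_{x > a+t} e(t, ·) = ∫_{a+T}^{a+t} [(φ_t + φ_x)² + Vφ²](x − a, x) dx` — the
drop of the far energy beyond the moving edge `x = a + τ` over `[T, t]` is the outgoing flux through
that edge. [folklore] -/
theorem farEnergy_drop_eq_flux (hφ : IsSolution V φ) (hE : totalEnergy V φ 0 ≠ ⊤) (a : ℝ)
    {T t : ℝ} (hT : 0 ≤ T) (hTt : T ≤ t) :
    (∫ x in Ioi (a + T), energyDensity V φ T x) - (∫ x in Ioi (a + t), energyDensity V φ t x)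
      = ∫ x in (a + T)..(a + t), ((deriv (fun τ => φ τ x) (x - a) + deriv (φ (x - a)) x) ^ 2
        + V x * φ (x - a) x ^ 2) := by
  have hsol : ∀ t x, iteratedDeriv 2 (fun τ => φ τ x) t - iteratedDeriv 2 (φ t) x + V x * φ t x = 0 :=
    fun t x => hφ.2 (t, x)
  have hiT := (farEnergy_eq_ofReal hV hV0 hφ hE a hT).1
  have hit := (farEnergy_eq_ofReal hV hV0 hφ hE a (hT.trans hTt)).1
  exact le_antisymm (drop_le_flux hV.continuous hV0 hφ.1 hsol hTt hiT hit)
    (flux_le_drop hV.continuous hV0 hφ.1 hsol hTt hiT hit)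

/-- The total energy of the sum of two finite-energy `C²` functions is finite
(`e[u + v] ≤ 2e[u] + 2e[v]`, `LostPSD.setLIntegral_energyDensity_add_le`). [folklore] -/
theorem totalEnergy_add_ne_top (hu : ContDiff ℝ 2 (Function.uncurry u))
    (hv : ContDiff ℝ 2 (Function.uncurry v)) {τ : ℝ} (hEu : totalEnergy V u τ ≠ ⊤)
    (hEv : totalEnergy V v τ ≠ ⊤) : totalEnergy V (fun t x => u t x + v t x) τ ≠ ⊤ := by
  have h := LostPSD.setLIntegral_energyDensity_add_le hV hV0 hu hv one_pos τ Set.univ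
  simp only [Measure.restrict_univ] at h
  unfold totalEnergy at hEu hEv ⊢
  exact ne_top_of_le_ne_top (ENNReal.add_ne_top.2 ⟨ENNReal.mul_ne_top ENNReal.ofReal_ne_top hEu,
    ENNReal.mul_ne_top ENNReal.ofReal_ne_top hEv⟩) h

end Solutions

/-- Bookkeeping in `[0, ∞]`: for nonnegative reals,
`ofReal a + ofReal α · ofReal c + ofReal β · ofReal e = ofReal (a + αc + βe)`. [folklore] -/
theorem ofReal_combo {a c e α β : ℝ} (ha : 0 ≤ a) (hc : 0 ≤ c) (he : 0 ≤ e) (hα : 0 ≤ α)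
    (hβ : 0 ≤ β) :
    ENNReal.ofReal a + ENNReal.ofReal α * ENNReal.ofReal c + ENNReal.ofReal β * ENNReal.ofReal e
      = ENNReal.ofReal (a + α * c + β * e) := by
  rw [ENNReal.ofReal_add (by positivity) (by positivity), ENNReal.ofReal_add ha (by positivity),
    ENNReal.ofReal_mul hα, ENNReal.ofReal_mul hβ]

end DropPSD

/-- **The one-sided windowed energy drop is a positive semidefinite quadratic form** (registered stub
`stub_dropPSD` of line `Sketch`, crux stmt-FinalStateConjecture-14085).  For a differentiable
potential `V ≥ 0`, two finite-energy global `C²` solutions `u, v`, an edge `a`, a weight `η > 0` and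
times `0 ≤ T ≤ t`:
`far_T(u + v) + (1 + η) far_t(u) + (1 + η⁻¹) far_t(v) ≤ far_t(u + v) + (1 + η) far_T(u) + (1 + η⁻¹) far_T(v)`
(`far_τ = farEnergy V a · τ`), i.e. `drop(u + v) ≤ (1 + η) drop(u) + (1 + η⁻¹) drop(v)` for the drops
`drop(φ) = far_T(φ) − far_t(φ)`, which by the flux identity `DropPSD.farEnergy_drop_eq_flux` are the
integrals over `[a + T, a + t]` of the pointwise positive semidefinite edge flux
`(φ_t + φ_x)² + Vφ²` (`DropPSD.integral_flux_add_le`). [folklore] -/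
theorem stub_dropPSD : ∀ (V : ℝ → ℝ), Differentiable ℝ V → (∀ x, 0 ≤ V x) →
    ∀ u v : ℝ → ℝ → ℝ, IsSolution V u → IsSolution V v → totalEnergy V u 0 ≠ ⊤ → totalEnergy V v 0 ≠ ⊤ →
    ∀ a η T t : ℝ, 0 < η → 0 ≤ T → T ≤ t →
      farEnergy V a (fun t x => u t x + v t x) T
          + ENNReal.ofReal (1 + η) * farEnergy V a u t + ENNReal.ofReal (1 + η⁻¹) * farEnergy V a v t
        ≤ farEnergy V a (fun t x => u t x + v t x) t
          + ENNReal.ofReal (1 + η) * farEnergy V a u T + ENNReal.ofReal (1 + η⁻¹) * farEnergy V a v T := by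
  intro V hV hV0 u v hu hv hEu hEv a η T t hη hT hTt
  have ht : 0 ≤ t := hT.trans hTt
  have huv : IsSolution V (fun t x => u t x + v t x) := Duality.isSolution_add hu hv
  have hEuv : totalEnergy V (fun t x => u t x + v t x) 0 ≠ ⊤ :=
    DropPSD.totalEnergy_add_ne_top hV hV0 hu.1 hv.1 hEu hEv
  -- the six far energies as real integrals
  obtain ⟨-, eST⟩ := DropPSD.farEnergy_eq_ofReal hV hV0 huv hEuv a hT
  obtain ⟨-, eSt⟩ := DropPSD.farEnergy_eq_ofReal hV hV0 huv hEuv a ht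
  obtain ⟨-, eUT⟩ := DropPSD.farEnergy_eq_ofReal hV hV0 hu hEu a hT
  obtain ⟨-, eUt⟩ := DropPSD.farEnergy_eq_ofReal hV hV0 hu hEu a ht
  obtain ⟨-, eVT⟩ := DropPSD.farEnergy_eq_ofReal hV hV0 hv hEv a hT
  obtain ⟨-, eVt⟩ := DropPSD.farEnergy_eq_ofReal hV hV0 hv hEv a ht
  -- the three drops are edge fluxes, and the edge flux is positive semidefinite
  have fS := DropPSD.farEnergy_drop_eq_flux hV hV0 huv hEuv a hT hTt
  have fU := DropPSD.farEnergy_drop_eq_flux hV hV0 hu hEu a hT hTt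
  have fV := DropPSD.farEnergy_drop_eq_flux hV hV0 hv hEv a hT hTt
  have hPSD := DropPSD.integral_flux_add_le hV.continuous hV0 hu.1 hv.1 hη a hTt
  rw [← fS, ← fU, ← fV] at hPSD
  -- bookkeeping in `[0, ∞]`
  have n : ∀ (φ : ℝ → ℝ → ℝ) (τ : ℝ), 0 ≤ ∫ x in Ioi (a + τ), energyDensity V φ τ x := fun φ τ =>
    setIntegral_nonneg measurableSet_Ioi fun x _ => energyDensity_nonneg φ τ (hV0 x)
  have hα : (0 : ℝ) ≤ 1 + η := by positivity
  have hβ : (0 : ℝ) ≤ 1 + η⁻¹ := by positivity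
  rw [eST, eSt, eUT, eUt, eVT, eVt, DropPSD.ofReal_combo (n _ _) (n _ _) (n _ _) hα hβ,
    DropPSD.ofReal_combo (n _ _) (n _ _) (n _ _) hα hβ]
  exact ENNReal.ofReal_le_ofReal (by linarith)

end Summit.FinalStateConjecture.FinalStateConjecture.Theorems.WindowedShellChannelsSketch
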